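import Literature.Analysis.Calculus.SeeleyExtension
import Mathlib.Geometry.Manifold.ContMDiff.Atlas
import Mathlib.Geometry.Manifold.ContMDiff.NormedSpace
import Mathlib.Geometry.Manifold.ContMDiff.Constructions
import Mathlib.Geometry.Manifold.Instances.Real
import Mathlib.Analysis.SpecialFunctions.SmoothTransition
import HarnessLib

/-!
# Seeley extension across the bottom of a cylinder `S × [0, δ)`

Topic `Literature/Topology/FourManifolds`.  Everything here is PROVED; no named facts, one
explicit construction (`cylinderExtend`).

Let `S` be a `C^∞` manifold without boundary (model `I`, `I.Boundaryless`) and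
`g : S × ℝ → F` a function with values in a complete normed space which is `C^∞` on the slab
`S × [0, δ)` in Mathlib's within-a-set sense (one-sided in the second variable along the bottom
`S × {0}`).  Then `g` agrees on `S × [0, δ)` with a function `C^∞` on the open set
`S × (-∞, δ)` (`contMDiffOn_cylinderExtend`), and on `S × [0, δ/2)` with a function `C^∞` on all
of `S × ℝ` (`exists_contMDiff_eq_on_slab`).  This is R. T. Seeley's extension theorem
(*Extension of `C^∞` functions defined in a half space*, Proc. AMS 15 (1964), 625–626:
`E f (x, t) = ∑ₖ aₖ φ(bₖ t) f(x, bₖ t)` for `t < 0`) applied fibre by fibre in the height variable: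
`cylinderExtend δ g (x, t)` is the tree's Seeley operator `Literature.Analysis.Calculus.Seeley.extend`
(`SeeleyExtension.lean`) applied to `t ↦ g (x, t)`.  Read in a chart `φ × id` of `S × ℝ` it is
the Seeley extension of the coordinate expression `(s, z) ↦ g (φ⁻¹ z, s)` — Seeley's operator acts
in the height variable only (`cylinderExtend_eq_extend_chart`) — which is `C^∞` on
`(-∞, δ) × φ.target` by the tree's `Seeley.contDiffOn_extend`.  The same device, for families of
tangent vectors instead of scalar functions, is the tree's `timeExtend`
(`Literature/Geometry/Manifold/TimeDependentFlowIcc.lean`); this file is its scalar analogue, used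
to supply the two-sided height function of a collar germ (`CollarGerm.height`, `CollarGerm.lean`)
from one-sided data.

## References

* R. T. Seeley, *Extension of `C^∞` functions defined in a half space*, Proc. Amer. Math. Soc.
  15 (1964), 625–626, Theorem. [Seeley1964]
-/

open scoped Manifold ContDiff Topology
open Set Function Filter

noncomputable section

namespace Literature.Topology.FourManifolds

open Literature.Analysis.Calculus

variable {E H : Type*} [NormedAddCommGroup E] [NormedSpace ℝ E] [TopologicalSpace H]
  {I : ModelWithCorners ℝ E H} {S : Type*} [TopologicalSpace S] [ChartedSpace H S]
  {F : Type*} [NormedAddCommGroup F] [NormedSpace ℝ F]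

/-- **Fibrewise Seeley extension on a cylinder**: for `g : S × ℝ → F`, the function
`cylinderExtend δ g (x, t)` is `g (x, t)` for `t ≥ 0` and Seeley's series
`∑ₖ aₖ φ(2ᵏ t / δ) g (x, -2ᵏ t)` for `t < 0` (the tree's `Seeley.extend` applied to
`t ↦ g (x, t)`). [cite: Seeley1964, Theorem] -/
def cylinderExtend (δ : ℝ) (g : S × ℝ → F) (q : S × ℝ) : F :=
  Seeley.extend (E' := Unit) (F := F) δ (fun p : ℝ × Unit => g (q.1, p.1)) (q.2, ())

omit [TopologicalSpace S] [ChartedSpace H S] in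
/-- Above the bottom the extension is `g`. [cite: Seeley1964, Theorem] -/
theorem cylinderExtend_of_nonneg {δ : ℝ} (g : S × ℝ → F) {q : S × ℝ} (hq : 0 ≤ q.2) :
    cylinderExtend δ g q = g q :=
  Seeley.extend_of_nonneg (E' := Unit) (F := F) (δ := δ) (f := fun p : ℝ × Unit => g (q.1, p.1))
    (p := (q.2, ())) hq

/-- **The fibrewise extension read in a chart is the Seeley extension of the coordinate
expression**: for `x` in the chart domain of `x₁` (extended chart `φ`) and every `t`,
`cylinderExtend δ g (x, t) = Seeley.extend δ Gc (t, φ x)` with `Gc (s, z) = g (φ⁻¹ z, s)`, because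
Seeley's operator acts in the height variable only (termwise equality of the series). [folklore] -/
theorem cylinderExtend_eq_extend_chart {δ : ℝ} (g : S × ℝ → F) (x₁ : S) {x : S}
    (hx : x ∈ (chartAt H x₁).source) (t : ℝ) :
    cylinderExtend δ g (x, t) =
      Seeley.extend δ (fun r : ℝ × E => g ((extChartAt I x₁).symm r.2, r.1))
        (t, extChartAt I x₁ x) := by
  have hxs : x ∈ (extChartAt I x₁).source := by rwa [extChartAt_source]
  have hleft : (extChartAt I x₁).symm (extChartAt I x₁ x) = x := (extChartAt I x₁).left_inv hxs
  rcases le_or_gt 0 t with ht | ht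
  · rw [cylinderExtend_of_nonneg g (q := (x, t)) ht,
      Seeley.extend_of_nonneg (p := (t, extChartAt I x₁ x)) ht]
    simp only [hleft]
  · rw [cylinderExtend, Seeley.extend_of_neg (p := (t, ())) ht,
      Seeley.extend_of_neg (p := (t, extChartAt I x₁ x)) ht]
    refine tsum_congr fun k => ?_
    simp only [Seeley.term, Seeley.scale_apply, hleft]

variable [I.Boundaryless] [CompleteSpace F]

/-- **Seeley's extension of a function `C^∞` on the slab `S × [0, δ)` is `C^∞` on
`S × (-∞, δ)`**: in the chart `φ × id` at `(x₁, 0)` the coordinate expression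
`Gc (s, z) = g (φ⁻¹ z, s)` of `g` is `C^∞` on `[0, δ) × φ.target` in the within sense, so its
Seeley extension is `C^∞` on `(-∞, δ) × φ.target` (`Seeley.contDiffOn_extend`, Seeley 1964), and
the fibrewise extension is that function composed with `(x, t) ↦ (t, φ x)`
(`cylinderExtend_eq_extend_chart`). [cite: Seeley1964, Theorem] -/
theorem contMDiffOn_cylinderExtend [IsManifold I ∞ S] {δ : ℝ} (hδ : 0 < δ) {g : S × ℝ → F}
    (hg : ContMDiffOn (I.prod 𝓘(ℝ, ℝ)) 𝓘(ℝ, F) ∞ g (univ ×ˢ Ico 0 δ)) :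
    ContMDiffOn (I.prod 𝓘(ℝ, ℝ)) 𝓘(ℝ, F) ∞ (cylinderExtend δ g) (univ ×ˢ Iio δ) := by
  rintro ⟨x₁, t₁⟩ ⟨-, ht₁⟩
  set φ := extChartAt I x₁ with hφ
  -- `g` read in the chart `φ × id` of `S × ℝ` at `(x₁, 0)` (the target chart of `F` is trivial)
  have key := (contMDiffOn_iff.1 hg).2 (x₁, 0) (g (x₁, 0))
  have hset : (extChartAt (I.prod 𝓘(ℝ, ℝ)) (x₁, (0 : ℝ))).target ∩
      (extChartAt (I.prod 𝓘(ℝ, ℝ)) (x₁, (0 : ℝ))).symm ⁻¹'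
        (univ ×ˢ Ico 0 δ ∩ g ⁻¹' (extChartAt 𝓘(ℝ, F) (g (x₁, 0))).source) =
      φ.target ×ˢ Ico 0 δ := by
    ext ⟨z, s⟩
    simp only [extChartAt_prod, PartialEquiv.prod_target, PartialEquiv.prod_symm,
      PartialEquiv.prod_coe, extChartAt_model_space_eq_id, PartialEquiv.refl_target,
      PartialEquiv.refl_symm, PartialEquiv.refl_coe, PartialEquiv.refl_source, preimage_univ,
      inter_univ, mem_inter_iff, mem_prod, mem_univ, and_true, mem_preimage, hφ, id, true_and]
  rw [hset] at key
  -- the coordinate expression in Seeley's variable order, smooth on the slab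
  set Gc : ℝ × E → F := fun r => g (φ.symm r.2, r.1) with hGc_def
  have hGc : ContDiffOn ℝ ∞ Gc (Seeley.slab δ φ.target) := by
    have hswap : ContDiff ℝ ∞ (fun r : ℝ × E => ((r.2, r.1) : E × ℝ)) :=
      contDiff_snd.prodMk contDiff_fst
    refine (key.comp hswap.contDiffOn fun r hr => mk_mem_prod hr.2 hr.1).congr fun r _ => ?_
    change Gc r = extChartAt 𝓘(ℝ, F) (g (x₁, 0))
      (g ((extChartAt (I.prod 𝓘(ℝ, ℝ)) (x₁, (0 : ℝ))).symm (r.2, r.1)))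
    rw [extChartAt_prod]
    simp only [PartialEquiv.prod_symm, PartialEquiv.prod_coe, extChartAt,
      OpenPartialHomeomorph.extend]
    rfl
  have hext : ContDiffOn ℝ ∞ (Seeley.extend δ Gc) (Iio δ ×ˢ φ.target) :=
    Seeley.contDiffOn_extend hδ (isOpen_extChartAt_target x₁) hGc
  -- the composite `q ↦ Seeley.extend δ Gc (q.2, φ q.1)` is `C^∞` at `(x₁, t₁)`
  have hin : ContMDiffAt (I.prod 𝓘(ℝ, ℝ)) 𝓘(ℝ, ℝ × E) ∞ (fun q : S × ℝ => ((q.2, φ q.1) : ℝ × E))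
      (x₁, t₁) :=
    contMDiffAt_snd.prodMk_space
      ((contMDiffAt_extChartAt (x := x₁)).comp (x₁, t₁) contMDiffAt_fst)
  have hG : ContMDiffAt (I.prod 𝓘(ℝ, ℝ)) 𝓘(ℝ, F) ∞
      (fun q : S × ℝ => Seeley.extend δ Gc (q.2, φ q.1)) (x₁, t₁) :=
    ContDiffAt.comp_contMDiffAt (f := fun q : S × ℝ => ((q.2, φ q.1) : ℝ × E)) (x := (x₁, t₁))
      (hext.contDiffAt ((isOpen_Iio.prod (isOpen_extChartAt_target x₁)).mem_nhds
        (mk_mem_prod ht₁ (mem_extChartAt_target x₁)))) hin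
  apply ContMDiffAt.contMDiffWithinAt
  refine hG.congr_of_eventuallyEq ?_
  have hev : ∀ᶠ q : S × ℝ in 𝓝 (x₁, t₁), q.1 ∈ (chartAt H x₁).source :=
    continuousAt_fst.preimage_mem_nhds ((chartAt H x₁).open_source.mem_nhds
      (mem_chart_source H x₁))
  filter_upwards [hev] with q hq
  exact cylinderExtend_eq_extend_chart g x₁ hq q.2

/-- **Smooth extension from the slab `S × [0, δ)` to the whole cylinder.**  A function `C^∞` on
`S × [0, δ)` (within sense) agrees on `S × [0, δ/2)` with a function `C^∞` on all of `S × ℝ`: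
Seeley extension across the bottom (`cylinderExtend`), then multiplication by a smooth cutoff in
the height which is `1` below `δ/2` and `0` above `3δ/4` (Mathlib's `Real.smoothTransition`).
[cite: Seeley1964, Theorem] -/
theorem exists_contMDiff_eq_on_slab [IsManifold I ∞ S] {δ : ℝ} (hδ : 0 < δ) {g : S × ℝ → F}
    (hg : ContMDiffOn (I.prod 𝓘(ℝ, ℝ)) 𝓘(ℝ, F) ∞ g (univ ×ˢ Ico 0 δ)) :
    ∃ G : S × ℝ → F, ContMDiff (I.prod 𝓘(ℝ, ℝ)) 𝓘(ℝ, F) ∞ G ∧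
      ∀ x, ∀ t ∈ Ico 0 (δ / 2), G (x, t) = g (x, t) := by
  set χ : ℝ → ℝ := fun t => Real.smoothTransition ((3 * δ / 4 - t) / (δ / 4)) with hχ
  have hχs : ContDiff ℝ ∞ χ :=
    Real.smoothTransition.contDiff.comp ((contDiff_const.sub contDiff_id).div_const _)
  have hχ1 : ∀ t, t ≤ δ / 2 → χ t = 1 := fun t ht =>
    Real.smoothTransition.one_of_one_le ((one_le_div (by positivity)).2 (by linarith))
  have hχ0 : ∀ t, 3 * δ / 4 ≤ t → χ t = 0 := fun t ht =>
    Real.smoothTransition.zero_of_nonpos (div_nonpos_of_nonpos_of_nonneg (by linarith)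
      (by positivity))
  refine ⟨fun q => χ q.2 • cylinderExtend δ g q, ?_, fun x t ht => ?_⟩
  · intro q
    by_cases hq : q.2 < δ
    · have h1 : ContMDiffAt (I.prod 𝓘(ℝ, ℝ)) 𝓘(ℝ, F) ∞ (cylinderExtend δ g) q :=
        (contMDiffOn_cylinderExtend hδ hg).contMDiffAt
          ((isOpen_univ.prod isOpen_Iio).mem_nhds ⟨mem_univ _, hq⟩)
      have h2 : ContMDiffAt (I.prod 𝓘(ℝ, ℝ)) 𝓘(ℝ, ℝ × F) ∞
          (fun q : S × ℝ => ((χ q.2, cylinderExtend δ g q) : ℝ × F)) q :=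
        ((hχs.contMDiff.comp contMDiff_snd) q).prodMk_space h1
      exact (contDiff_smul (𝕜 := ℝ) (F := F)).contDiffAt.comp_contMDiffAt h2
    · -- above `3δ/4` the function vanishes identically near `q`
      have hev : (fun q : S × ℝ => χ q.2 • cylinderExtend δ g q) =ᶠ[𝓝 q] fun _ => 0 := by
        have hO : IsOpen {q : S × ℝ | 3 * δ / 4 < q.2} :=
          isOpen_lt continuous_const continuous_snd
        refine eventuallyEq_of_mem (hO.mem_nhds ?_) fun q' hq' => ?_
        · show 3 * δ / 4 < q.2
          linarith [not_lt.1 hq]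
        · show χ q'.2 • cylinderExtend δ g q' = 0
          rw [hχ0 _ (le_of_lt hq'), zero_smul]
      exact contMDiffAt_const.congr_of_eventuallyEq hev
  · show χ t • cylinderExtend δ g (x, t) = g (x, t)
    rw [hχ1 t ht.2.le, one_smul, cylinderExtend_of_nonneg g (q := (x, t)) ht.1]

end Literature.Topology.FourManifolds

end
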